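import Literature.Topology.FourManifolds.TrisectionsAmbientMorse
import Literature.Topology.FourManifolds.TrisectionsSectorRecognition
import HarnessLib

/-!
# Ambient presentation of a sector of a Gay–Kirby trisection (export form of the normal form
# with an ambient Morse function)

Topic `Literature/Topology/FourManifolds`; infrastructure for the fact seat
`provefact-Literature.Topology.FourManifolds.exists-14560f9fc8` (named fact (c′)
`Literature.Topology.FourManifolds.exists_stabilized_gkTrisection`).  Everything in this file
is **proved**; no definitions, no named facts.

`TrisectionsAmbientMorse.lean` (`hasHandleDecomposition_of_normalForm`) presents the handle
decomposition of a sector `S i` in normal form by the ambient function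
`G = 1 - (1 - χ)(1 - F_ext) - χ · 2uv · K ∘ ρ`, but only exports the resulting handle
decomposition of the re-structured sector.  The stabilisation surgery (Gay–Kirby 2016, Def. 8),
performed in the product coordinates near the central surface `F`, modifies the *ambient data*
themselves and recognises the new sectors afterwards
(`TrisectionsSectorRecognition.lean`, `sectorClause_of_ambient`).  This file therefore exports
the ambient function together with exactly the properties consumed by the recognition theorem,
phrased through the interior of `S i` in `X`:

**Theorem (`exists_ambientPresentation_of_normalForm`).**  *In the setting of
`hasHandleDecomposition_of_normalForm` (sector manifold `e : W → X` of `S i` with adapted Morse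
function `f` and counts `c`; normal coordinates `u, v` on `U`; retraction `ρ` of `O` onto `F`,
the identity on `F`; corner-slice charts of `S i` along `F`) there are smooth `G, κ : X → ℝ`
and an open `Oκ` with `F ⊆ Oκ ⊆ O` such that: `κ > 0` and `κ ∘ ρ = κ` on `Oκ`;
`G = 1 - 2uv · κ` on the* whole *of `Oκ`; `G = 1` at the non-interior points of `S i` and
`G < 1` at the interior ones; `G` is regular at the non-interior points off `F` and at all
points of `S i ∩ Oκ` off `F`; the interior critical points of `G` are nondegenerate and there
are `c n` of them of each index `n`; moreover the interior points of `S i` inside `U` are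
exactly the points with `u, v > 0`.*  Here `κ = K ∘ ρ` and `Oκ = V₁ ∩ {u² + v² < η/2}` is the
region where the cutoff `χ` equals `1`; the proof is that of
`hasHandleDecomposition_of_normalForm` with the conclusions read before the passage to the
straightened structure (corner points are not interior to `S i`,
`CornerSliceChart.not_mem_interior_of_mem_K`).

## References

* D. Gay, R. Kirby, *Trisecting 4-manifolds*, Geom. Topol. 20 (2016) 3097–3132, Def. 1 and
  Def. 8. [GayKirby2016]
* J. Milnor, *Morse theory*, Ann. of Math. Studies 51 (1963), §§2–3. [Milnor1963]
* J. Milnor, *Lectures on the h-cobordism theorem* (1965), Def. 3.1 and §3. [MilnorHCobordism1965]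
-/

open scoped Manifold ContDiff Topology
open Set Function Filter

noncomputable section

namespace Literature.Topology.FourManifolds

universe u

section Export

variable {X : Type u} [TopologicalSpace X] [T2Space X] [CompactSpace X]
  [ChartedSpace (EuclideanSpace ℝ (Fin 4)) X] [IsManifold (𝓡 4) ∞ X]
  {g : ℕ} {k : Fin 3 → ℕ} {S : Fin 3 → Set X}

/-- **Ambient presentation of a sector in normal form** (export form of
`hasHandleDecomposition_of_normalForm`).  Data: the sector manifold `e : W → X` of `S i`
(embedding onto `S i`, corner charts over `F = ⋂ S m`, faces images of boundary points,
immersion off `F`) with a Morse function `f` adapted to `∂W` and critical-point counts `c`;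
normal coordinates `u, v` cutting out `S i`, its faces and `F` in an open `U ⊇ F`; a smooth
retraction `ρ` of an open `O` (`F ⊆ O ⊆ U`) into `F` fixing `F`; corner-slice charts of `S i`
relative to `(F, u, v, ρ)` at the points of `F`.  Conclusion: smooth `G, κ` and an open `Oκ`,
`F ⊆ Oκ ⊆ O`, with `κ > 0`, `κ ∘ ρ = κ` and `G = 1 - 2uv · κ` on `Oκ`, the interior points of
`S i` in `U` being those with `u, v > 0`, `G = 1` exactly at the non-interior points of `S i`, `G < 1` at the interior points, `G` regular at the non-interior
points off `F` and on `S i ∩ Oκ ∖ F`, nondegenerate at the interior critical points, of which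
there are `c n` of index `n`. [cite: GayKirby2016, Def. 1; Milnor1963, §§2–3] -/
theorem exists_ambientPresentation_of_normalForm {i : Fin 3}
    {W : Type u} [TopologicalSpace W] [ChartedSpace (EuclideanHalfSpace 4) W]
    [IsManifold (𝓡∂ 4) ∞ W] [CompactSpace W]
    {e : W → X} (he : Topology.IsEmbedding e) (hrange : range e = S i)
    (himm : ∀ w, e w ∉ (⋂ m, S m) → Manifold.IsImmersionAt (𝓡∂ 4) (𝓡 4) ∞ e w)
    (hcor : ∀ w, e w ∈ (⋂ m, S m) → IsCornerAt e w)
    (hbd : ∀ j, j ≠ i → S i ∩ S j ⊆ e '' (𝓡∂ 4).boundary W)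
    {f : W → ℝ} (hf : IsMorseAdapted (𝓡∂ 4) f) {c : ℕ → ℕ}
    (hcount : ∀ n, (criticalSetOfIndex (𝓡∂ 4) f n).ncard = c n)
    {u v : X → ℝ} (hu : ContMDiff (𝓡 4) 𝓘(ℝ, ℝ) ∞ u) (hv : ContMDiff (𝓡 4) 𝓘(ℝ, ℝ) ∞ v)
    {U : Set X} (hUo : IsOpen U)
    (hSi : ∀ y ∈ U, y ∈ S i ↔ 0 ≤ u y ∧ 0 ≤ v y)
    (hF : ∀ y ∈ U, y ∈ (⋂ m, S m) ↔ u y = 0 ∧ v y = 0)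
    (hface : ∀ y ∈ U, y ∈ S i → (u y = 0 ∨ v y = 0) → ∃ j', j' ≠ i ∧ y ∈ S j')
    (hFc : IsCompact (⋂ m, S m))
    {O : Set X} {ρ : X → X} (hOo : IsOpen O) (hFO : (⋂ m, S m) ⊆ O) (hOU : O ⊆ U)
    (hρs : ContMDiff (𝓡 4) (𝓡 4) ∞ ρ) (hρF : ∀ y ∈ O, ρ y ∈ ⋂ m, S m)
    (hρfix : ∀ y ∈ U, u y = 0 → v y = 0 → ρ y = y)
    (hcd : ∀ x ∈ ⋂ m, S m, ∃ C : CornerSliceChart (S i) (⋂ m, S m) u v ρ, x ∈ C.Θ.source) :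
    ∃ (G κ : X → ℝ) (Oκ : Set X), ContMDiff (𝓡 4) 𝓘(ℝ, ℝ) ∞ G ∧ ContMDiff (𝓡 4) 𝓘(ℝ, ℝ) ∞ κ ∧
      IsOpen Oκ ∧ (⋂ m, S m) ⊆ Oκ ∧ Oκ ⊆ O ∧ (∀ y ∈ Oκ, 0 < κ y) ∧ (∀ y ∈ Oκ, κ (ρ y) = κ y) ∧
      (∀ y ∈ Oκ, G y = 1 - 2 * u y * v y * κ y) ∧
      (∀ y ∈ U, y ∈ S i → (y ∈ interior (S i) ↔ 0 < u y ∧ 0 < v y)) ∧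
      (∀ p ∈ S i, p ∉ interior (S i) → G p = 1) ∧
      (∀ p ∈ interior (S i), G p < 1) ∧
      (∀ p ∈ S i, p ∉ interior (S i) → p ∉ (⋂ m, S m) → ¬ IsMCriticalPt (𝓡 4) G p) ∧
      (∀ p ∈ interior (S i), IsMCriticalPt (𝓡 4) G p → (mhessian (𝓡 4) G p).Nondegenerate) ∧
      (∀ p ∈ S i, p ∈ Oκ → p ∉ (⋂ m, S m) → ¬ IsMCriticalPt (𝓡 4) G p) ∧
      (∀ n, (interior (S i) ∩ criticalSetOfIndex (𝓡 4) G n).ncard = c n) := by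
  -- abbreviate the central surface (reverting the data whose types mention it)
  revert himm hcor hF hFc hFO hρF hcd
  set F : Set X := ⋂ m, S m with hFdef
  intro himm hcor hF hFc hFO hρF hcd
  have hFclosed : IsClosed F := hFc.isClosed
  have hFU : F ⊆ U := hFO.trans hOU
  have hSic : IsCompact (S i) := by rw [← hrange]; exact isCompact_range he.continuous
  have hSiclosed : IsClosed (S i) := hSic.isClosed
  -- charts adapted to `(u, v)` along `F`, from the corner-slice charts
  have hchart : ∀ x ∈ F, ∃ Ξ : OpenPartialHomeomorph X (EuclideanSpace ℝ (Fin 4)),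
      Ξ ∈ IsManifold.maximalAtlas (𝓡 4) ∞ X ∧ x ∈ Ξ.source ∧
      ∀ y ∈ Ξ.source, Ξ y 0 = u y ∧ Ξ y 1 = v y := by
    intro x hx
    obtain ⟨C, hxC⟩ := hcd x hx
    exact ⟨C.Θ, C.Θ_mem_maximalAtlas, hxC, fun y hy => ⟨C.apply_zero y hy, C.apply_one y hy⟩⟩
  -- corner points are not interior to `S i`
  have hFnotint : ∀ x ∈ F, x ∉ interior (S i) := fun x hx => by
    obtain ⟨C, hxC⟩ := hcd x hx
    exact C.not_mem_interior_of_mem_K hxC hx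
  -- ### the cornered Hadamard lemma along `F`
  obtain ⟨O_K, K, hOKo, hFOK, hKs, hKpos, hKid⟩ :=
    exists_cornerHadamard_global he hrange hcor hbd hf hUo hSi hF hface hFU hFc hchart
  -- ### the cutoff data
  set V : Set X := O ∩ O_K with hV
  have hVo : IsOpen V := hOo.inter hOKo
  have hFV : F ⊆ V := fun x hx => ⟨hFO hx, hFOK hx⟩
  have hVzero : ∀ y ∈ V, u y = 0 → v y = 0 → y ∈ F := fun y hy hu0 hv0 =>
    (hF y (hOU hy.1)).2 ⟨hu0, hv0⟩
  obtain ⟨V₁, η₀, hV₁o, hFV₁, hclV₁, hη₀, hfront, hcut⟩ :=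
    exists_localised_cutoff' hFclosed hVo hFV hu hv hVzero
  have hV₁V : V₁ ⊆ V := subset_closure.trans hclV₁
  -- ### uniform chart constants on `S i ∩ closure V₁`
  have hZ₀c : IsCompact (S i ∩ closure V₁) := hSic.inter_right isClosed_closure
  have hzeroF : ∀ y ∈ S i ∩ closure V₁, u y = 0 → v y = 0 → y ∈ F := fun y hy hu0 hv0 =>
    hVzero y (hclV₁ hy.2) hu0 hv0
  obtain ⟨m, C, η₁, hm, hC, hη₁, hconst⟩ := exists_uniform_chart_constants hFc hcd hKs hOKo hFOK
    hKpos hu.continuous hv.continuous hZ₀c hzeroF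
  -- ### the critical points of `f` stay away from `F`
  have hr2c : Continuous fun y => u y ^ 2 + v y ^ 2 :=
    (hu.continuous.pow 2).add (hv.continuous.pow 2)
  obtain ⟨η₂, hη₂, hη₂crit⟩ : ∃ η₂ : ℝ, 0 < η₂ ∧
      ∀ w, IsMCriticalPt (𝓡∂ 4) f w → e w ∈ closure V₁ → η₂ < u (e w) ^ 2 + v (e w) ^ 2 := by
    have hcl : IsClosed (criticalSet (𝓡∂ 4) f) :=
      isClosed_criticalSet_of_contMDiff hf.isMorse.contMDiff (by norm_cast)
    set Z₂ : Set X := e '' criticalSet (𝓡∂ 4) f ∩ closure V₁ with hZ₂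
    have hZ₂c : IsCompact Z₂ := (hcl.isCompact.image he.continuous).inter_right isClosed_closure
    rcases Z₂.eq_empty_or_nonempty with hZe | hZne
    · refine ⟨1, one_pos, fun w hw hwcl => ?_⟩
      have : e w ∈ Z₂ := ⟨⟨w, hw, rfl⟩, hwcl⟩
      rw [hZe] at this; exact absurd this (notMem_empty _)
    · obtain ⟨y₀, hy₀, hmin⟩ := hZ₂c.exists_isMinOn hZne hr2c.continuousOn
      obtain ⟨⟨w₀, hw₀crit, hw₀y⟩, hy₀cl⟩ := hy₀
      have hpos : 0 < u y₀ ^ 2 + v y₀ ^ 2 := by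
        by_contra hle
        have h0 : u y₀ ^ 2 + v y₀ ^ 2 = 0 := le_antisymm (not_lt.1 hle) (by positivity)
        have hu0 : u y₀ = 0 := by nlinarith [sq_nonneg (u y₀), sq_nonneg (v y₀)]
        have hv0 : v y₀ = 0 := by nlinarith [sq_nonneg (u y₀), sq_nonneg (v y₀)]
        have hy₀S : y₀ ∈ S i := by rw [← hrange, ← hw₀y]; exact mem_range_self _
        have hyF : y₀ ∈ F := hzeroF y₀ ⟨hy₀S, hy₀cl⟩ hu0 hv0
        -- a point over `F` is a boundary point, hence regular
        obtain ⟨j', hj', hyj'⟩ := hface y₀ (hFU hyF) hy₀S (Or.inl hu0)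
        obtain ⟨w', hw'b, hw'e⟩ := hbd j' hj' ⟨hy₀S, hyj'⟩
        rw [← hw₀y] at hw'e
        rw [he.injective hw'e] at hw'b
        exact (hf.2.1 w₀ hw'b).2 hw₀crit
      refine ⟨(u y₀ ^ 2 + v y₀ ^ 2) / 2, by linarith, fun w hw hwcl => ?_⟩
      have := hmin (show e w ∈ Z₂ from ⟨⟨w, hw, rfl⟩, hwcl⟩)
      rw [mem_setOf_eq] at this
      linarith
  -- ### the cutoff profile constant and the choice of `η`
  obtain ⟨hχ₁s, hχ₁01, hχ₁one, hχ₁zero, Cχ, hCχ, hχ₁C⟩ := cutoffProfile_props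
  -- `η` small: below `η₀`, `η₁`, `η₂` and the no-critical-point threshold
  obtain ⟨η, hη, hηη₀, hηη₁, hηη₂, hηsmall⟩ : ∃ η : ℝ, 0 < η ∧ η ≤ η₀ ∧ η ≤ η₁ ∧ η ≤ η₂ ∧
      Real.sqrt η * (C * (1 + 2 * Cχ)) < m := by
    set A : ℝ := C * (1 + 2 * Cχ) with hA
    have hA0 : 0 ≤ A := by positivity
    set s₀ : ℝ := m / (2 * (A + 1)) with hs₀
    have hs₀pos : 0 < s₀ := by positivity
    set η' : ℝ := min (min (min η₀ η₁) η₂) (s₀ ^ 2) with hη'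
    refine ⟨η', lt_min (lt_min (lt_min hη₀ hη₁) hη₂) (by positivity),
      (min_le_left _ _).trans ((min_le_left _ _).trans (min_le_left _ _)),
      (min_le_left _ _).trans ((min_le_left _ _).trans (min_le_right _ _)),
      (min_le_left _ _).trans (min_le_right _ _), ?_⟩
    have h1 : Real.sqrt η' ≤ s₀ := by
      calc Real.sqrt η' ≤ Real.sqrt (s₀ ^ 2) := Real.sqrt_le_sqrt (min_le_right _ _)
        _ = s₀ := Real.sqrt_sq hs₀pos.le
    calc Real.sqrt η' * A ≤ s₀ * A := mul_le_mul_of_nonneg_right h1 hA0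
      _ = m * (A / (2 * (A + 1))) := by rw [hs₀]; ring
      _ < m * 1 := by
          refine mul_lt_mul_of_pos_left ?_ hm
          rw [div_lt_one (by positivity)]; linarith
      _ = m := mul_one m
  -- ### the cutoff `χ`
  obtain ⟨χ, hχs, hχ01, hχV₁, hχout⟩ := hcut η hη hηη₀
  -- ### the extension of `f` off a small neighbourhood `V₀` of `F`
  set r2 : X → ℝ := fun y => u y ^ 2 + v y ^ 2 with hr2
  have hr2s : ContMDiff (𝓡 4) 𝓘(ℝ, ℝ) ∞ r2 := (hu.pow 2).add (hv.pow 2)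
  set V₀ : Set X := V₁ ∩ r2 ⁻¹' Iio (η / 4) with hV₀
  have hV₀o : IsOpen V₀ := hV₁o.inter (isOpen_Iio.preimage hr2s.continuous)
  have hFV₀ : F ⊆ V₀ := fun x hx => ⟨hFV₁ hx, by
    obtain ⟨hu0, hv0⟩ := (hF x (hFU hx)).1 hx
    show r2 x < η / 4; simp only [hr2, hu0, hv0]; norm_num; linarith⟩
  have himm' : ∀ w, e w ∉ F → Manifold.IsImmersionAt (𝓡∂ 4) (𝓡 4) ∞ e w := himm
  have hrangec : IsClosed (range e) := by rw [hrange]; exact hSiclosed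
  obtain ⟨Fext, hFexts, hFextf⟩ := exists_contMDiff_extension_off he hrangec himm'
    hf.isMorse.contMDiff hV₀o hFV₀
  -- ### the ambient function
  set G : X → ℝ := fun y => 1 - (1 - χ y) * (1 - Fext y) - χ y * (2 * u y * v y * K (ρ y)) with hG
  have hGs : ContMDiff (𝓡 4) 𝓘(ℝ, ℝ) ∞ G :=
    (contMDiff_const.sub ((contMDiff_const.sub hχs).mul (contMDiff_const.sub hFexts))).sub
      (hχs.mul (((contMDiff_const.mul hu).mul hv).mul (hKs.comp hρs)))
  -- ### the formula on `S i ∩ V₁`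
  have hformula : ∀ w, e w ∈ V₁ →
      G (e w) = 1 - 2 * u (e w) * v (e w) * ((1 - χ (e w)) * K (e w) + χ (e w) * K (ρ (e w))) := by
    intro w hw
    set y := e w with hy
    have hyOK : y ∈ O_K := (hV₁V hw).2
    by_cases hV : y ∈ V₀
    · -- here `χ = 1`
      have hχ1 : χ y = 1 := by
        rw [hχV₁ y hw]
        apply hχ₁one
        have : r2 y < η / 4 := hV.2
        rw [div_le_iff₀ hη]; simp only [hr2] at this; linarith
      simp only [hG, hχ1, sub_self, zero_mul, sub_zero, one_mul, zero_add]
    · have hFf : Fext y = f w := hFextf w hV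
      have hid : 1 - f w = 2 * u y * v y * K y := hKid w hyOK
      simp only [hG, hFf]
      rw [hid]; ring
  -- ### interior points of `S i` (in `X`) versus interior points of `W`
  have hWint : ∀ w, e w ∉ F → (e w ∈ interior (S i) ↔ (𝓡∂ 4).IsInteriorPoint w) := by
    intro w hwF
    constructor
    · intro hint
      rw [← hrange] at hint
      exact (apply_lt_one_of_mem_interior_range he hf (himm w hwF) hint).2
    · intro hint
      rw [← hrange]
      exact apply_mem_interior_range_of_isInteriorPoint (himm w hwF) hint
  have hflt : ∀ w, e w ∉ F → e w ∈ interior (S i) → f w < 1 := fun w hwF hint =>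
    (apply_lt_one_of_mem_interior_range he hf (himm w hwF) (by rw [hrange]; exact hint)).1
  have hfone : ∀ w, e w ∉ F → e w ∉ interior (S i) → f w = 1 := by
    intro w hwF hnot
    have hbw : (𝓡∂ 4).IsBoundaryPoint w := by
      rw [ModelWithCorners.isBoundaryPoint_iff_not_isInteriorPoint]
      exact fun hint => hnot ((hWint w hwF).2 hint)
    exact (hf.2.1 w hbw).1
  -- interior points of `S i` inside `U` have `u, v > 0`; non-interior points have `u v = 0`
  have huvpos : ∀ w, e w ∉ F → e w ∈ U → e w ∈ interior (S i) → 0 < u (e w) ∧ 0 < v (e w) := by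
    intro w hwF hyU hint
    have hyS : e w ∈ S i := by rw [← hrange]; exact mem_range_self w
    obtain ⟨hu0, hv0⟩ := (hSi _ hyU).1 hyS
    have hwint : (𝓡∂ 4).IsInteriorPoint w := (hWint w hwF).1 hint
    have hnotbd : ∀ j', j' ≠ i → e w ∉ S j' := by
      intro j' hj' hmem
      obtain ⟨w', hw'b, hw'e⟩ := hbd j' hj' ⟨hyS, hmem⟩
      rw [he.injective hw'e] at hw'b
      exact (ModelWithCorners.isInteriorPoint_iff_not_isBoundaryPoint _ |>.1 hwint) hw'b
    refine ⟨lt_of_le_of_ne hu0 fun h0 => ?_, lt_of_le_of_ne hv0 fun h0 => ?_⟩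
    · obtain ⟨j', hj', hmem⟩ := hface _ hyU hyS (Or.inl h0.symm)
      exact hnotbd j' hj' hmem
    · obtain ⟨j', hj', hmem⟩ := hface _ hyU hyS (Or.inr h0.symm)
      exact hnotbd j' hj' hmem
  have huvzero : ∀ y ∈ S i, y ∈ U → y ∉ interior (S i) → u y * v y = 0 := by
    intro y hyS hyU hnot
    obtain ⟨hu0, hv0⟩ := (hSi y hyU).1 hyS
    by_contra hne
    have hu' : 0 < u y := lt_of_le_of_ne hu0 fun h0 => hne (by rw [← h0, zero_mul])
    have hv' : 0 < v y := lt_of_le_of_ne hv0 fun h0 => hne (by rw [← h0, mul_zero])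
    apply hnot
    have hopen : IsOpen (U ∩ (u ⁻¹' Ioi 0 ∩ v ⁻¹' Ioi 0)) :=
      hUo.inter ((isOpen_Ioi.preimage hu.continuous).inter (isOpen_Ioi.preimage hv.continuous))
    exact mem_interior.2 ⟨_, fun z hz => (hSi z hz.1).2 ⟨le_of_lt hz.2.1, le_of_lt hz.2.2⟩, hopen,
      ⟨hyU, hu', hv'⟩⟩
  -- ### the shrunk corner data: sources inside `V₁` with `χ = 1` and `u² + v² < η / 2`
  -- ### far from `F`: the cutoff vanishes identically, so `G ∘ e = f`
  have hfarN : ∀ y, (y ∉ V₁ ∨ η < r2 y) → ∃ N : Set X, IsOpen N ∧ y ∈ N ∧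
      ∀ z ∈ N, χ z = 0 ∧ z ∉ V₀ := by
    intro y hy
    -- on `{r2 > η}` and off `V₁` the cutoff vanishes and `V₀` is avoided
    have hbig : ∀ z, η < r2 z → χ z = 0 ∧ z ∉ V₀ := by
      intro z hz
      refine ⟨?_, fun hV => ?_⟩
      · by_cases hzV₁ : z ∈ V₁
        · rw [hχV₁ z hzV₁]
          exact hχ₁zero _ (by rw [le_div_iff₀ hη]; simp only [hr2] at hz; linarith)
        · exact hχout z hzV₁
      · have : r2 z < η / 4 := hV.2
        linarith
    have hoff : ∀ z, z ∉ V₁ → χ z = 0 ∧ z ∉ V₀ := fun z hz => ⟨hχout z hz, fun hV => hz hV.1⟩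
    rcases hy with hyV₁ | hyr
    · by_cases hycl : y ∈ closure V₁
      · have hr : η₀ < r2 y := hfront y hycl hyV₁
        refine ⟨r2 ⁻¹' Ioi η, isOpen_Ioi.preimage hr2s.continuous, ?_, fun z hz => hbig z hz⟩
        show η < r2 y; linarith
      · refine ⟨(closure V₁)ᶜ, isClosed_closure.isOpen_compl, hycl, fun z hz => hoff z ?_⟩
        exact fun hzV₁ => hz (subset_closure hzV₁)
    · exact ⟨r2 ⁻¹' Ioi η, isOpen_Ioi.preimage hr2s.continuous, hyr, fun z hz => hbig z hz⟩
  have hfar : ∀ w, (e w ∉ V₁ ∨ η < r2 (e w)) → ∀ᶠ w' in 𝓝 w, G (e w') = f w' := by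
    intro w hw
    obtain ⟨N, hNo, hwN, hN⟩ := hfarN (e w) hw
    have h1 : ∀ᶠ w' in 𝓝 w, e w' ∈ N :=
      he.continuous.continuousAt.preimage_mem_nhds (hNo.mem_nhds hwN)
    filter_upwards [h1] with w' hw'
    obtain ⟨hχ0, hV₀⟩ := hN _ hw'
    simp only [hG, hχ0, sub_zero, one_mul, zero_mul, hFextf w' hV₀, sub_sub_cancel]
  -- ### near `F`: the formula in a corner-slice chart, and no critical points
  have hchartformula : ∀ (Cc : CornerSliceChart (S i) F u v ρ) (z : EuclideanSpace ℝ (Fin 4)),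
      z ∈ Cc.Θ.target → 0 ≤ z 0 → 0 ≤ z 1 → Cc.Θ.symm z ∈ V₁ →
      G (Cc.Θ.symm z) = 1 - 2 * z 0 * z 1 *
        ((1 - Real.smoothTransition (2 - 2 * ((z 0 ^ 2 + z 1 ^ 2) / η))) * K (Cc.Θ.symm z) +
          Real.smoothTransition (2 - 2 * ((z 0 ^ 2 + z 1 ^ 2) / η)) *
            K (Cc.Θ.symm (stratumProj z))) := by
    intro Cc z hz hz0 hz1 hzV₁
    set y := Cc.Θ.symm z with hy
    have hysrc : y ∈ Cc.Θ.source := Cc.Θ.map_target hz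
    have hΘy : Cc.Θ y = z := Cc.Θ.right_inv hz
    have hyS : y ∈ S i := Cc.symm_mem hz ⟨hz0, hz1⟩
    obtain ⟨w, hw⟩ : y ∈ range e := by rw [hrange]; exact hyS
    have hf' := hformula w (by rw [hw]; exact hzV₁)
    rw [hw] at hf'
    have huy : u y = z 0 := by rw [← Cc.apply_zero y hysrc, hΘy]
    have hvy : v y = z 1 := by rw [← Cc.apply_one y hysrc, hΘy]
    have hχy : χ y = Real.smoothTransition (2 - 2 * ((z 0 ^ 2 + z 1 ^ 2) / η)) := by
      rw [hχV₁ y hzV₁, huy, hvy]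
    have hρy : K (ρ y) = K (Cc.Θ.symm (stratumProj z)) := by
      rw [hy, Cc.π_symm_eq hz]
    rw [hf', huy, hvy, hχy, hρy]
  have hnear : ∀ y ∈ S i, y ∉ F → y ∈ V₁ → r2 y ≤ η → ¬ IsMCriticalPt (𝓡 4) G y := by
    intro y hyS hyF hyV₁ hyr
    have hyU : y ∈ U := hOU (hV₁V hyV₁).1
    obtain ⟨hu0, hv0⟩ := (hSi y hyU).1 hyS
    obtain ⟨Cc, qm, R, hysrc, hyball, hballT, hqm0, hqm1, hballOK, hbds⟩ :=
      hconst y ⟨hyS, subset_closure hyV₁⟩ (hyr.trans hηη₁)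
    set q : EuclideanSpace ℝ (Fin 4) := Cc.Θ y with hq
    have hq0 : q 0 = u y := Cc.apply_zero y hysrc
    have hq1 : q 1 = v y := Cc.apply_one y hysrc
    have hqtgt : q ∈ Cc.Θ.target := Cc.Θ.map_source hysrc
    have hsymmq : Cc.Θ.symm q = y := Cc.Θ.left_inv hysrc
    -- not both normal coordinates vanish
    have hne : ¬ (u y = 0 ∧ v y = 0) := fun h0 => hyF ((hF y hyU).2 h0)
    -- `G` read in the chart
    set Gh : EuclideanSpace ℝ (Fin 4) → ℝ := G ∘ Cc.Θ.symm with hGh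
    have hGhs : ContDiffAt ℝ ∞ Gh q := by
      have h1 : ContMDiffOn 𝓘(ℝ, EuclideanSpace ℝ (Fin 4)) 𝓘(ℝ, ℝ) ∞ Gh Cc.Θ.target :=
        hGs.comp_contMDiffOn Cc.contMDiffOn_symm
      exact (contMDiffOn_iff_contDiffOn.mp h1).contDiffAt (Cc.Θ.open_target.mem_nhds hqtgt)
    have hGhd : DifferentiableAt ℝ Gh q := hGhs.differentiableAt (by simp)
    -- the Morse-critical point condition read in the chart `Cc.Θ`
    have hmem2 : Cc.Θ ∈ IsManifold.maximalAtlas (𝓡 4) 2 X :=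
      IsManifold.maximalAtlas_subset_of_le (M := X) (I := 𝓡 4) ENat.LEInfty.out
        Cc.Θ_mem_maximalAtlas
    have hcrit_iff : IsMCriticalPt (𝓡 4) G y ↔ fderiv ℝ Gh q = 0 := by
      rw [isMCriticalPt_iff_fderiv_comp_extend_symm_eq_zero (I := 𝓡 4)
        ((hGs.contMDiffAt (x := y)).of_le ENat.LEInfty.out) hmem2 hysrc]
      have h1 : (G ∘ (Cc.Θ.extend (𝓡 4)).symm) = Gh := by ext z; simp [hGh]
      have h2 : Cc.Θ.extend (𝓡 4) y = q := by simp [hq]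
      rw [h1, h2]
    rw [hcrit_iff]
    -- constants and bounds in the ball
    have hKd' : ∀ z ∈ Metric.ball qm R, DifferentiableAt ℝ (K ∘ Cc.Θ.symm) z :=
      fun z hz => (hbds z hz).1
    have hKC' : ∀ z ∈ Metric.ball qm R, ‖fderiv ℝ (K ∘ Cc.Θ.symm) z‖ ≤ C :=
      fun z hz => (hbds z hz).2.1
    have hKm' : ∀ z ∈ Metric.ball qm R, m ≤ (K ∘ Cc.Θ.symm) z := fun z hz => (hbds z hz).2.2
    have hχd : Differentiable ℝ fun x : ℝ => Real.smoothTransition (2 - 2 * x) :=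
      hχ₁s.differentiable (by simp)
    -- points of the line stay in the good region
    have hV₁near : ∀ᶠ z in 𝓝 q, z ∈ Metric.ball qm R ∧ Cc.Θ.symm z ∈ V₁ := by
      have h1 : ∀ᶠ z in 𝓝 q, z ∈ Metric.ball qm R := Metric.isOpen_ball.mem_nhds hyball
      have h2 : ∀ᶠ z in 𝓝 q, Cc.Θ.symm z ∈ V₁ := by
        have hc : ContinuousAt Cc.Θ.symm q := Cc.Θ.continuousAt_symm hqtgt
        apply hc.preimage_mem_nhds
        rw [hsymmq]; exact hV₁o.mem_nhds hyV₁
      exact h1.and h2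
    by_cases hv : 0 < v y
    · -- move in the `u`-direction
      set e0 : EuclideanSpace ℝ (Fin 4) := EuclideanSpace.single 0 (1:ℝ) with he0
      have ha : ∀ s : ℝ, (q + s • e0) 0 = q 0 + s := fun s => by simp [he0]
      have hb : ∀ s : ℝ, (q + s • e0) 1 = q 1 := fun s => by simp [he0]
      have hsP : ∀ s : ℝ, stratumProj (q + s • e0) = stratumProj q := fun s => by
        ext i'; fin_cases i' <;> simp [stratumProj, he0]
      obtain ⟨g', hg'neg, hg'⟩ := hasDerivAt_interp_line_neg (Kh := K ∘ Cc.Θ.symm)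
        (χ₁ := fun x : ℝ => Real.smoothTransition (2 - 2 * x)) (η := η) (qm := qm) (q := q)
        hKd' hKC' hKm' hC hχd hχ₁C hχ₁01 hCχ ⟨hqm0, hqm1⟩ hyball
        (by rw [hq0]; exact hu0) (by rw [hq1]; exact hv) hη (by rw [hq0, hq1]; exact hyr) hηsmall
      have hline : Tendsto (fun s : ℝ => q + s • e0) (𝓝 0) (𝓝 q) := by
        have : Continuous fun s : ℝ => q + s • e0 := by fun_prop
        simpa using this.tendsto 0
      have heq : ∀ᶠ s in 𝓝[≥] (0:ℝ), Gh (q + s • e0) = 1 - 2 * (q 0 + s) * q 1 *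
          ((1 - Real.smoothTransition (2 - 2 * (((q 0 + s) ^ 2 + q 1 ^ 2) / η))) *
              (K ∘ Cc.Θ.symm) (q + s • e0) +
            Real.smoothTransition (2 - 2 * (((q 0 + s) ^ 2 + q 1 ^ 2) / η)) *
              (K ∘ Cc.Θ.symm) (stratumProj q)) := by
        filter_upwards [(hline.eventually hV₁near).filter_mono nhdsWithin_le_nhds,
          self_mem_nhdsWithin] with s hs hs0
        have hs0' : (0:ℝ) ≤ s := hs0
        have h := hchartformula Cc (q + s • e0) (hballT hs.1) (by rw [ha, hq0]; linarith)
          (by rw [hb, hq1]; exact hv0) hs.2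
        simp only [hGh, comp_apply]
        rw [h, ha, hb, hsP]
      exact fderiv_ne_zero_of_eventuallyEq_line hGhd hg' hg'neg.ne heq
    · -- `v y = 0`, so `u y > 0`: move in the `v`-direction
      have hv0' : v y = 0 := le_antisymm (not_lt.1 hv) hv0
      have hu : 0 < u y := lt_of_le_of_ne hu0 fun h0 => hne ⟨h0.symm, hv0'⟩
      set e1 : EuclideanSpace ℝ (Fin 4) := EuclideanSpace.single 1 (1:ℝ) with he1
      have ha : ∀ s : ℝ, (q + s • e1) 1 = q 1 + s := fun s => by simp [he1]
      have hb : ∀ s : ℝ, (q + s • e1) 0 = q 0 := fun s => by simp [he1]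
      have hsP : ∀ s : ℝ, stratumProj (q + s • e1) = stratumProj q := fun s => by
        ext i'; fin_cases i' <;> simp [stratumProj, he1]
      obtain ⟨g', hg'neg, hg'⟩ := hasDerivAt_interp_line_neg' (Kh := K ∘ Cc.Θ.symm)
        (χ₁ := fun x : ℝ => Real.smoothTransition (2 - 2 * x)) (η := η) (qm := qm) (q := q)
        hKd' hKC' hKm' hC hχd hχ₁C hχ₁01 hCχ ⟨hqm0, hqm1⟩ hyball
        (by rw [hq1]; exact hv0) (by rw [hq0]; exact hu) hη (by rw [hq0, hq1, add_comm]; exact hyr)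
        hηsmall
      have hline : Tendsto (fun s : ℝ => q + s • e1) (𝓝 0) (𝓝 q) := by
        have : Continuous fun s : ℝ => q + s • e1 := by fun_prop
        simpa using this.tendsto 0
      have heq : ∀ᶠ s in 𝓝[≥] (0:ℝ), Gh (q + s • e1) = 1 - 2 * (q 1 + s) * q 0 *
          ((1 - Real.smoothTransition (2 - 2 * (((q 1 + s) ^ 2 + q 0 ^ 2) / η))) *
              (K ∘ Cc.Θ.symm) (q + s • e1) +
            Real.smoothTransition (2 - 2 * (((q 1 + s) ^ 2 + q 0 ^ 2) / η)) *
              (K ∘ Cc.Θ.symm) (stratumProj q)) := by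
        filter_upwards [(hline.eventually hV₁near).filter_mono nhdsWithin_le_nhds,
          self_mem_nhdsWithin] with s hs hs0
        have hs0' : (0:ℝ) ≤ s := hs0
        have h := hchartformula Cc (q + s • e1) (hballT hs.1) (by rw [hb, hq0]; exact hu0)
          (by rw [ha, hq1]; linarith) hs.2
        simp only [hGh, comp_apply]
        rw [h, ha, hb, hsP]
        ring_nf
      exact fderiv_ne_zero_of_eventuallyEq_line hGhd hg' hg'neg.ne heq
  -- the dichotomy near / far, for points off `F`
  have hdich : ∀ y, (y ∈ V₁ ∧ r2 y ≤ η) ∨ (y ∉ V₁ ∨ η < r2 y) := by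
    intro y
    by_cases h1 : y ∈ V₁
    · by_cases h2 : r2 y ≤ η
      · exact Or.inl ⟨h1, h2⟩
      · exact Or.inr (Or.inr (not_le.1 h2))
    · exact Or.inr (Or.inl h1)
  -- ### regular at the boundary points off `F`
  -- ### interior points of `S i` in `U` are the points of the open quadrant
  have hint_iff : ∀ y ∈ U, y ∈ S i → (y ∈ interior (S i) ↔ 0 < u y ∧ 0 < v y) := by
    intro y hyU hyS
    constructor
    · intro hint
      have hyF : y ∉ F := fun h => hFnotint y h hint
      obtain ⟨w, hw⟩ : y ∈ range e := by rw [hrange]; exact hyS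
      have := huvpos w (by rw [hw]; exact hyF) (by rw [hw]; exact hyU) (by rw [hw]; exact hint)
      rwa [hw] at this
    · rintro ⟨hu', hv'⟩
      have hopen : IsOpen (U ∩ (u ⁻¹' Ioi 0 ∩ v ⁻¹' Ioi 0)) :=
        hUo.inter ((isOpen_Ioi.preimage hu.continuous).inter (isOpen_Ioi.preimage hv.continuous))
      exact mem_interior.2 ⟨_, fun z hz => (hSi z hz.1).2 ⟨le_of_lt hz.2.1, le_of_lt hz.2.2⟩, hopen,
        ⟨hyU, hu', hv'⟩⟩
  -- ### `G = 1` at the non-interior points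
  have hb1 : ∀ p ∈ S i, p ∉ interior (S i) → G p = 1 := by
    intro p hpS hnot
    obtain ⟨w, hw⟩ : p ∈ range e := by rw [hrange]; exact hpS
    by_cases hpF : p ∈ F
    · obtain ⟨hu0, hv0⟩ := (hF p (hFU hpF)).1 hpF
      have := hformula w (by rw [hw]; exact hFV₁ hpF)
      rw [hw] at this
      rw [this, hu0, hv0]; ring
    · by_cases hpV₁ : p ∈ V₁
      · have hf' := hformula w (by rw [hw]; exact hpV₁)
        rw [hw] at hf'
        rw [hf', mul_assoc 2 (u p) (v p), huvzero p hpS (hOU (hV₁V hpV₁).1) hnot]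
        ring
      · have hχ0 : χ p = 0 := hχout p hpV₁
        have hV₀' : e w ∉ V₀ := fun hV => hpV₁ (hw ▸ hV.1)
        have hFf : Fext p = f w := by rw [← hw]; exact hFextf w hV₀'
        have hf1 : f w = 1 := hfone w (by rw [hw]; exact hpF) (by rw [hw]; exact hnot)
        simp only [hG, hχ0, sub_zero, zero_mul, one_mul, hFf, hf1, sub_self]
  -- ### `G < 1` at the interior points
  have hi1 : ∀ p ∈ interior (S i), G p < 1 := by
    intro p hint
    have hpS : p ∈ S i := interior_subset hint
    have hpF : p ∉ F := fun hpF => hFnotint p hpF hint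
    obtain ⟨w, hw⟩ : p ∈ range e := by rw [hrange]; exact hpS
    by_cases hpV₁ : p ∈ V₁
    · have hf' := hformula w (by rw [hw]; exact hpV₁)
      rw [hw] at hf'
      rw [hf']
      have hyU : p ∈ U := hOU (hV₁V hpV₁).1
      obtain ⟨hu', hv'⟩ := huvpos w (by rw [hw]; exact hpF) (by rw [hw]; exact hyU)
        (by rw [hw]; exact hint)
      rw [hw] at hu' hv'
      have hK1 : 0 < K p := hKpos _ (hV₁V hpV₁).2
      have hK2 : 0 < K (ρ p) := hKpos _ (hFOK (hρF _ (hV₁V hpV₁).1))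
      have hχp := hχ01 p
      have hmix : 0 < (1 - χ p) * K p + χ p * K (ρ p) := by
        rcases hχp.1.lt_or_eq with hlt | heq0
        · nlinarith
        · rw [← heq0]; simpa using hK1
      nlinarith [mul_pos (mul_pos hu' hv') hmix]
    · have hχ0 : χ p = 0 := hχout p hpV₁
      have hV₀' : e w ∉ V₀ := fun hV => hpV₁ (hw ▸ hV.1)
      have hFf : Fext p = f w := by rw [← hw]; exact hFextf w hV₀'
      have hflt' : f w < 1 := hflt w (by rw [hw]; exact hpF) (by rw [hw]; exact hint)
      simp only [hG, hχ0, sub_zero, zero_mul, one_mul, hFf]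
      linarith
  -- ### regular at the non-interior points off `F`
  have hb2 : ∀ p ∈ S i, p ∉ interior (S i) → p ∉ F → ¬ IsMCriticalPt (𝓡 4) G p := by
    intro p hpS hnot hpF
    obtain ⟨w, hw⟩ : p ∈ range e := by rw [hrange]; exact hpS
    rcases hdich p with ⟨hV₁, hr⟩ | hfarp
    · exact hnear p hpS hpF hV₁ hr
    · have hwb : (𝓡∂ 4).IsBoundaryPoint w := by
        rw [ModelWithCorners.isBoundaryPoint_iff_not_isInteriorPoint]
        exact fun hint => hnot (hw ▸ (hWint w (by rw [hw]; exact hpF)).2 hint)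
      have hreg : ¬ IsMCriticalPt (𝓡∂ 4) f w := (hf.2.1 w hwb).2
      have heq := hfar w (by rw [hw]; exact hfarp)
      rw [← hw]
      exact not_isMCriticalPt_of_comp_eventuallyEq
        ((himm w (by rw [hw]; exact hpF)).contMDiffAt.mdifferentiableAt (by simp))
        (hGs.contMDiffAt.mdifferentiableAt (by simp)) heq hreg
  -- ### nondegenerate at the interior critical points (all far from `F`)
  have hi2 : ∀ p ∈ interior (S i), IsMCriticalPt (𝓡 4) G p →
      (mhessian (𝓡 4) G p).Nondegenerate := by
    intro p hint hcrit
    have hpS : p ∈ S i := interior_subset hint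
    have hpF : p ∉ F := fun hpF => hFnotint p hpF hint
    obtain ⟨w, hw⟩ : p ∈ range e := by rw [hrange]; exact hpS
    rcases hdich p with ⟨hV₁, hr⟩ | hfarp
    · exact absurd hcrit (hnear p hpS hpF hV₁ hr)
    · have hwint : (𝓡∂ 4).IsInteriorPoint w :=
        (hWint w (by rw [hw]; exact hpF)).1 (by rw [hw]; exact hint)
      have heq := hfar w (by rw [hw]; exact hfarp)
      obtain ⟨hiff, hdata⟩ := morseData_of_comp_eventuallyEq (himm w (by rw [hw]; exact hpF)) hwint
        hf.isMorse.contMDiff.contMDiffAt hGs.contMDiffAt heq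
      rw [hw] at hiff hdata
      obtain ⟨hnd, -⟩ := hdata hcrit
      exact hnd.1 (hf.isMorse.nondegenerate (hiff.2 hcrit))
  -- ### counting: the interior critical points of `G` are the images of those of `f`
  have hcount' : ∀ n : ℕ, (interior (S i) ∩ criticalSetOfIndex (𝓡 4) G n).ncard = c n := by
    intro n
    have hset : interior (S i) ∩ criticalSetOfIndex (𝓡 4) G n = e '' criticalSetOfIndex (𝓡∂ 4) f n := by
      ext y
      constructor
      · rintro ⟨hint, hcrit, hidx⟩
        have hyS : y ∈ S i := interior_subset hint
        have hpF : y ∉ F := fun hpF => hFnotint y hpF hint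
        obtain ⟨w, hw⟩ : y ∈ range e := by rw [hrange]; exact hyS
        rcases hdich y with ⟨hV₁, hr⟩ | hfarp
        · exact absurd hcrit (hnear y hyS hpF hV₁ hr)
        · have hwint : (𝓡∂ 4).IsInteriorPoint w :=
            (hWint w (by rw [hw]; exact hpF)).1 (by rw [hw]; exact hint)
          have heq := hfar w (by rw [hw]; exact hfarp)
          obtain ⟨hiff, hdata⟩ := morseData_of_comp_eventuallyEq (himm w (by rw [hw]; exact hpF))
            hwint hf.isMorse.contMDiff.contMDiffAt hGs.contMDiffAt heq
          rw [hw] at hiff hdata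
          obtain ⟨-, hidx'⟩ := hdata hcrit
          refine ⟨w, ⟨hiff.2 hcrit, ?_⟩, hw⟩
          rw [hidx', hidx]
      · rintro ⟨w, ⟨hcritw, hidxw⟩, rfl⟩
        -- a critical point of `f` is interior and far from `F`
        have hwF : e w ∉ F := by
          intro hwF
          have hyS : e w ∈ S i := by rw [← hrange]; exact mem_range_self w
          obtain ⟨hu0', -⟩ := (hF _ (hFU hwF)).1 hwF
          obtain ⟨j', hj', hyj'⟩ := hface _ (hFU hwF) hyS (Or.inl hu0')
          obtain ⟨w', hw'b, hw'e⟩ := hbd j' hj' ⟨hyS, hyj'⟩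
          rw [he.injective hw'e] at hw'b
          exact (hf.2.1 w hw'b).2 hcritw
        have hwint : (𝓡∂ 4).IsInteriorPoint w := by
          rcases (𝓡∂ 4).isInteriorPoint_or_isBoundaryPoint w with hwi | hwb
          · exact hwi
          · exact absurd hcritw (hf.2.1 w hwb).2
        have hint : e w ∈ interior (S i) := (hWint w hwF).2 hwint
        have hfarp : e w ∉ V₁ ∨ η < r2 (e w) := by
          by_cases hV₁ : e w ∈ V₁
          · exact Or.inr (lt_of_le_of_lt hηη₂ (hη₂crit w hcritw (subset_closure hV₁)))
          · exact Or.inl hV₁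
        have heq := hfar w hfarp
        obtain ⟨hiff, hdata⟩ := morseData_of_comp_eventuallyEq (himm w hwF) hwint
          hf.isMorse.contMDiff.contMDiffAt hGs.contMDiffAt heq
        have hcritG : IsMCriticalPt (𝓡 4) G (e w) := hiff.1 hcritw
        obtain ⟨-, hidx'⟩ := hdata hcritG
        exact ⟨hint, hcritG, by rw [← hidx', hidxw]⟩
    rw [hset, Set.ncard_image_of_injective _ he.injective, hcount n]
  -- ### the region `Oκ` where the cutoff equals `1`, and `κ = K ∘ ρ`
  set Oκ : Set X := V₁ ∩ r2 ⁻¹' Iio (η / 2) with hOκ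
  have hOκo : IsOpen Oκ := hV₁o.inter (isOpen_Iio.preimage hr2s.continuous)
  have hFOκ : F ⊆ Oκ := fun x hx => ⟨hFV₁ hx, by
    obtain ⟨hu0, hv0⟩ := (hF x (hFU hx)).1 hx
    show r2 x < η / 2; simp only [hr2, hu0, hv0]; norm_num; linarith⟩
  have hOκO : Oκ ⊆ O := fun y hy => (hV₁V hy.1).1
  have hχone : ∀ y ∈ Oκ, χ y = 1 := by
    rintro y ⟨hyV₁, hyr⟩
    rw [hχV₁ y hyV₁]
    apply hχ₁one
    have : r2 y < η / 2 := hyr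
    rw [div_le_iff₀ hη]; simp only [hr2] at this; linarith
  have hρρ : ∀ y ∈ O, ρ (ρ y) = ρ y := by
    intro y hy
    have hρyF : ρ y ∈ F := hρF y hy
    obtain ⟨hu0, hv0⟩ := (hF _ (hFU hρyF)).1 hρyF
    exact hρfix _ (hFU hρyF) hu0 hv0
  refine ⟨G, K ∘ ρ, Oκ, hGs, hKs.comp hρs, hOκo, hFOκ, hOκO, fun y hy => ?_, fun y hy => ?_,
    fun y hy => ?_, hint_iff, hb1, hi1, hb2, hi2, fun p hpS hpO hpF => ?_, hcount'⟩
  · exact hKpos _ (hFOK (hρF _ (hOκO hy)))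
  · show K (ρ (ρ y)) = K (ρ y)
    rw [hρρ y (hOκO hy)]
  · have hχ1 := hχone y hy
    show G y = 1 - 2 * u y * v y * K (ρ y)
    simp only [hG, hχ1, sub_self, zero_mul, sub_zero, one_mul]
  · have hr : r2 p ≤ η := by
      have : r2 p < η / 2 := hpO.2
      linarith
    exact hnear p hpS hpF hpO.1 hr

end Export

end Literature.Topology.FourManifolds
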